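/-
Copyright (c) 2026 the pub-hodgecm-mathlib formalisation cell (harness21).  Prover seat hodgecm-mathlib-K2Liu-p27 (g0), Track B «K2-LIT»,
#184♮ = hLiu418 = `stmt-HodgeConjecture-24832`; #42S organ S2, (R1) transport row: THE CONJUGATE DATUM OF FRAME-COMPACT TYPE (adapter for the GRAND-FINAL wrapper;
desk K2Liu-p05 (g6), wrapper K2Liu-p23 (g0) 2026-09-04T15:58:09Z, assembler F0P2-p08 (g0)).
-/
import Summits.HodgeConjecture.HodgeConjecture.Theorems.K2LiuSignBlockCompactPlaceSec          -- ★ B3 `exists_conj_archCompact_closure`, `archUFormPi_mem_range_iff_mem_closure`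
import Summits.HodgeConjecture.HodgeConjecture.Theorems.K2LiuArchSWRegionSpanningTransport      -- ★ (R1-c) `exists_iwasawaDatum_conj`
import HarnessLib

/-!
# Crux `HLiu418`, #42S organ S2, (R1) transport: EVERY STANDARD IWASAWA DATUM IS CONJUGATE TO ONE OF FRAME-COMPACT TYPE
# (`g`, `𝒦₀` with `k ∈ 𝒦₀.K ↔ g k g⁻¹ ∈ 𝒦.K`, and `hK₀(𝒦₀)` ∕ the `kV`-door for `hk1(𝒦₀)` — the three inputs of the GRAND-FINAL wrapper)

Cell `hodgecm-mathlib`, crux item hLiu418 = `stmt-HodgeConjecture-24832`; squad K2 ∕ K2Liu; LEAD F0P6-plan (g14), co-dealer K2E5-plan (g7), S2 desk K2Liu-p05 (g6); prover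
K2Liu-p27 (g0).  THEOREMS ONLY (no `def`, no instance, no notation, no named-fact hypothesis, no `sorry`); lane `--supports stmt-HodgeConjecture-24832 --as helper`.

WHY (GRAND-FINAL recipe, K2Liu-p23 (g0) 15:56:58Z ∕ 15:58:09Z; LEAD BATCH #50 (5) «(R1) TRANSPORT BY CONJUGACY CONFIRMED»).  ★ p861586
`K2LiuArchSWSpanningStd.archSWRegionSpanning_std_of_onePlaceSystem … (hk1) (hK₀)` closes `ArchSWRegionSpanning … 𝒦₀ χ` for data of FRAME-COMPACT TYPE; ★ (R1-c)
`archSWRegionSpanning_of_conj … (h𝒦 : ∀ k, k ∈ 𝒦₀.K ↔ c k c⁻¹ ∈ 𝒦.K) (h₀)` transports it to `𝒦`.  This adapter produces, for EVERY standard `𝒦`, the pair `(g, 𝒦₀)` with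
the conjugation law for `c := (g, 1_f)` AND the two frame-compact facts about `𝒦₀`, from ★ B2∕B3 (`exists_conj_archCompact_closure`) and ★ (R1-c) (`exists_iwasawaDatum_conj`):
* `exists_conjDatum_frameCompact (h𝒦 : 𝒦.IsStd) : ∃ g 𝒦₀, (∀ k, k ∈ 𝒦₀.K ↔ (g,1) k (g,1)⁻¹ ∈ 𝒦.K) ∧ (∀ a, (a,1) ∈ 𝒦₀.K ↔ a ∈ Submonoid.closure {placeSec σ (kV k₁)})`
  — the second conjunct «→» IS `hK₀(𝒦₀)` (★ p861314 ∕ ★ p861586 bytes), and «←» with ★ B3 `archUFormPi_mem_range_iff_mem_closure` gives `hk1(𝒦₀)` from p16's `kV`-range letters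
  (★ `K2LiuArchReadingFrameKdiag.fr_mem_kV_range`): `mem_conjDatum_of_kV_range`.
References: [Weil1964] Chap. I n° 8; [BorelJacquet1979] §4.1; [PlatonovRapinchuk1994] §3.2; [Tan1999] §1 p. 166.
HONEST LABEL.  Count-neutral helper: `HC_CM` is proved only modulo the 7 printed citations (2 remaining named inputs: hLiu418 = `stmt-HodgeConjecture-24832`,
h413 = `stmt-HodgeConjecture-24833`) until rung 0 closes; this file closes no socket.
-/

set_option autoImplicit false
set_option linter.dupNamespace false -- the mandated namespace repeats `HodgeConjecture.HodgeConjecture`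

noncomputable section

open scoped Matrix Classical
open NumberField NumberField.InfinitePlace NumberField.mixedEmbedding IsDedekindDomain
open Literature.NumberTheory.Automorphic Literature.NumberTheory.Automorphic.UnitaryGroup Literature.NumberTheory.Weil1964
open Literature.NumberTheory.GelbartRogawski1991 Literature.NumberTheory.GelbartRogawski1991.UnitaryDualPair
open Literature.NumberTheory.GelbartRogawski1991.UnitaryDualPair.LocalSplitting
open Literature.NumberTheory.GelbartRogawski1991.GRConstruction Literature.NumberTheory.K2Lit.SiegelDoubled
open Literature.RepresentationTheory.KonnoKonno2007 Literature.RepresentationTheory.KonnoKonno2007.RealDualPair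
open Summit.HodgeConjecture.HodgeConjecture.Cruxes.HLiu418 Summit.HodgeConjecture.HodgeConjecture.Cruxes.HLiu418.K2LiuArchSectionPlaceBlock
open Summit.HodgeConjecture.HodgeConjecture.Cruxes.HLiu418.K2LiuArchTensorPlaceSec
open Summit.HodgeConjecture.HodgeConjecture.Cruxes.HLiu418.K2LiuSignBlockCompactPlaceSec
open Summit.HodgeConjecture.HodgeConjecture.Cruxes.HLiu418.K2LiuArchSWRegionSpanningTransport

namespace Summit.HodgeConjecture.HodgeConjecture.Cruxes.HLiu418.K2LiuStdConjDatumFrameCompact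

variable (L : Type) [Field L] [NumberField L] [IsCMField L]
variable {N M n : ℕ} (e : Fin N × Fin M ≃ Fin n)
  (dV : Fin N → L) (hdV : ∀ i, IsCMField.complexConj L (dV i) = dV i) (hdV0 : ∀ i, dV i ≠ 0)
  (dW : Fin M → L) (hdW : ∀ i, IsCMField.complexConj L (dW i) = dW i) (hdW0 : ∀ i, dW i ≠ 0)

include hdV0 hdW0 in
/-- **EVERY STANDARD IWASAWA DATUM IS CONJUGATE TO ONE OF FRAME-COMPACT TYPE.**  For `𝒦.IsStd` there are `g ∈ H(L⁺ ⊗ ℝ)` and an Iwasawa datum `𝒦₀` with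
(i) `k ∈ 𝒦₀.K ↔ c · k · c⁻¹ ∈ 𝒦.K` for `c = (g, 1_f)` carried in `H(𝔸)` (★ (R1-c) `exists_iwasawaDatum_conj`; the binder shape ★ `archSWRegionSpanning_of_conj` consumes) and (ii) the archimedean part of `𝒦₀.K` is EXACTLY the
place-section compact: `(a, 1_f) ∈ 𝒦₀.K ↔ a ∈ Submonoid.closure {placeSec σ (kV k₁)}` (★ B3 `exists_conj_archCompact_closure`; `g⁻¹ (g a g⁻¹) g = a`).  Clause (ii) «→» is the
`hK₀` binder of ★ p861586 `archSWRegionSpanning_std_of_onePlaceSystem` at `𝒦₀`, byte for byte. [cite: Weil1964, Chap. I n° 8] [cite: PlatonovRapinchuk1994, §3.2]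
[cite: BorelJacquet1979, §4.1] -/
theorem exists_conjDatum_frameCompact {𝒦 : IwasawaDatum L e dV hdV dW hdW} (h𝒦 : 𝒦.IsStd) :
    ∃ (g : UnitaryGroup.arch (Fp L) L (IsCMField.complexConj L) (n + n) (hermD L e dV hdV dW hdW)) (𝒦₀ : IwasawaDatum L e dV hdV dW hdW)
      (c : HA L e dV hdV dW hdW), c = UnitaryGroup.archToAdelic (Fp L) L (IsCMField.complexConj L) (n + n) (hermD L e dV hdV dW hdW) g ∧
      (∀ k : HA L e dV hdV dW hdW, k ∈ 𝒦₀.K ↔ c * k * c⁻¹ ∈ 𝒦.K) ∧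
      ∀ a : UnitaryGroup.arch (Fp L) L (IsCMField.complexConj L) (n + n) (hermD L e dV hdV dW hdW),
        (UnitaryGroup.archToAdelic (Fp L) L (IsCMField.complexConj L) (n + n) (hermD L e dV hdV dW hdW) a : HA L e dV hdV dW hdW) ∈ 𝒦₀.K ↔
          a ∈ Submonoid.closure {k : UnitaryGroup.arch (Fp L) L (IsCMField.complexConj L) (n + n) (hermD L e dV hdV dW hdW) |
          ∃ (σ : {v : InfinitePlace (Fp L) // v.IsReal}) (k₁ : Matrix.unitaryGroup (PosIdx (signVec (cmPlaceOver L) (fun k => Sum.elim (cmGramEntry L e dV hdV dW hdW) (-cmGramEntry L e dV hdV dW hdW) ((LocalSplitting.e₂ n).symm k)) (imagUnit L) σ)) ℂ × Matrix.unitaryGroup (NegIdx (signVec (cmPlaceOver L) (fun k => Sum.elim (cmGramEntry L e dV hdV dW hdW) (-cmGramEntry L e dV hdV dW hdW) ((LocalSplitting.e₂ n).symm k)) (imagUnit L) σ)) ℂ),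
            k = placeSec L (IsCMField.complexConj L) (n + n) (IsCMField.complexConj_ne_one L) (cmPlaceOver L) (cmPlaceOver_smul L) (fun k => Sum.elim (cmGramEntry L e dV hdV dW hdW) (-cmGramEntry L e dV hdV dW hdW) ((LocalSplitting.e₂ n).symm k))
            (gramD_gram_realDiagonal_entry_ne_zero L e dV hdV dW hdW hdV0 hdW0) (complexConj_imagUnit L) (imagUnit_ne_zero L) σ
            (cmPlaceOver_comap L) (gramD_eq_diagonal_cm L e dV hdV dW hdW) (J := hermD L e dV hdV dW hdW) rfl
            (complexConj_smul_infinitePlace L) (UForm.kV _ _ k₁)} := by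
  obtain ⟨g, hg⟩ := exists_conj_archCompact_closure L e dV hdV hdV0 dW hdW hdW0 h𝒦
  obtain ⟨𝒦₀, h𝒦₀⟩ := exists_iwasawaDatum_conj L 𝒦
    (UnitaryGroup.archToAdelic (Fp L) L (IsCMField.complexConj L) (n + n) (hermD L e dV hdV dW hdW) g)
  refine ⟨g, 𝒦₀, UnitaryGroup.archToAdelic (Fp L) L (IsCMField.complexConj L) (n + n) (hermD L e dV hdV dW hdW) g, rfl, h𝒦₀, fun a => ?_⟩
  refine (h𝒦₀ _).trans (Iff.trans ?_ ((hg (g * a * g⁻¹)).trans ?_))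
  · -- `(g,1) (a,1) (g,1)⁻¹ = (g a g⁻¹, 1)`
    rw [map_mul, map_mul, map_inv]
    exact Iff.rfl
  · have hga : g⁻¹ * (g * a * g⁻¹) * g = a := by group
    rw [hga]

include hdV0 hdW0 in
/-- **THE `kV`-DOOR INTO `𝒦₀`**: under the law of `exists_conjDatum_frameCompact` (ii), an archimedean element whose sign-frame component lies in `(kV).range` at every real place
(p16's `hk1` letters, ★ `K2LiuArchReadingFrameKdiag.fr_mem_kV_range`) has `(a, 1_f) ∈ 𝒦₀.K` (★ B3 `archUFormPi_mem_range_iff_mem_closure` «→»).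
[cite: BorelJacquet1979, §4.1] [cite: KonnoKonno2007, §3.1] -/
theorem mem_conjDatum_of_kV_range {𝒦₀ : IwasawaDatum L e dV hdV dW hdW}
    (hlaw : ∀ a : UnitaryGroup.arch (Fp L) L (IsCMField.complexConj L) (n + n) (hermD L e dV hdV dW hdW),
        (UnitaryGroup.archToAdelic (Fp L) L (IsCMField.complexConj L) (n + n) (hermD L e dV hdV dW hdW) a : HA L e dV hdV dW hdW) ∈ 𝒦₀.K ↔
          a ∈ Submonoid.closure {k : UnitaryGroup.arch (Fp L) L (IsCMField.complexConj L) (n + n) (hermD L e dV hdV dW hdW) |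
          ∃ (σ : {v : InfinitePlace (Fp L) // v.IsReal}) (k₁ : Matrix.unitaryGroup (PosIdx (signVec (cmPlaceOver L) (fun k => Sum.elim (cmGramEntry L e dV hdV dW hdW) (-cmGramEntry L e dV hdV dW hdW) ((LocalSplitting.e₂ n).symm k)) (imagUnit L) σ)) ℂ × Matrix.unitaryGroup (NegIdx (signVec (cmPlaceOver L) (fun k => Sum.elim (cmGramEntry L e dV hdV dW hdW) (-cmGramEntry L e dV hdV dW hdW) ((LocalSplitting.e₂ n).symm k)) (imagUnit L) σ)) ℂ),
            k = placeSec L (IsCMField.complexConj L) (n + n) (IsCMField.complexConj_ne_one L) (cmPlaceOver L) (cmPlaceOver_smul L) (fun k => Sum.elim (cmGramEntry L e dV hdV dW hdW) (-cmGramEntry L e dV hdV dW hdW) ((LocalSplitting.e₂ n).symm k))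
            (gramD_gram_realDiagonal_entry_ne_zero L e dV hdV dW hdW hdV0 hdW0) (complexConj_imagUnit L) (imagUnit_ne_zero L) σ
            (cmPlaceOver_comap L) (gramD_eq_diagonal_cm L e dV hdV dW hdW) (J := hermD L e dV hdV dW hdW) rfl
            (complexConj_smul_infinitePlace L) (UForm.kV _ _ k₁)})
    (a : UnitaryGroup.arch (Fp L) L (IsCMField.complexConj L) (n + n) (hermD L e dV hdV dW hdW))
    (ha : ∀ σ : {v : InfinitePlace (Fp L) // v.IsReal}, archUFormPi L (IsCMField.complexConj L) (n + n) (IsCMField.complexConj_ne_one L) (cmPlaceOver L) (cmPlaceOver_smul L) (cmPlaceOver_comap L) (fun k => Sum.elim (cmGramEntry L e dV hdV dW hdW) (-cmGramEntry L e dV hdV dW hdW) ((LocalSplitting.e₂ n).symm k))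
        (gramD_gram_realDiagonal_entry_ne_zero L e dV hdV dW hdW hdV0 hdW0) (gramD_eq_diagonal_cm L e dV hdV dW hdW) (J := hermD L e dV hdV dW hdW) rfl
        (complexConj_imagUnit L) (imagUnit_ne_zero L) a σ ∈
        (UForm.kV (PosIdx (signVec (cmPlaceOver L) (fun k => Sum.elim (cmGramEntry L e dV hdV dW hdW) (-cmGramEntry L e dV hdV dW hdW) ((LocalSplitting.e₂ n).symm k)) (imagUnit L) σ)) (NegIdx (signVec (cmPlaceOver L) (fun k => Sum.elim (cmGramEntry L e dV hdV dW hdW) (-cmGramEntry L e dV hdV dW hdW) ((LocalSplitting.e₂ n).symm k)) (imagUnit L) σ))).range) :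
    (UnitaryGroup.archToAdelic (Fp L) L (IsCMField.complexConj L) (n + n) (hermD L e dV hdV dW hdW) a : HA L e dV hdV dW hdW) ∈ 𝒦₀.K :=
  (hlaw a).2 ((archUFormPi_mem_range_iff_mem_closure L e dV hdV hdV0 dW hdW hdW0 a).1 ha)

end Summit.HodgeConjecture.HodgeConjecture.Cruxes.HLiu418.K2LiuStdConjDatumFrameCompact

end
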